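import Literature.MathematicalPhysics.QuantumFieldTheory.Balaban1983to89.Node00.Record12BgRowCoClassCPMFloor
import Literature.MathematicalPhysics.QuantumFieldTheory.Balaban1983to89.B11Thm1ExistsUniqueCoP7M
import Literature.MathematicalPhysics.QuantumFieldTheory.Balaban1983to89.B16Sect1Backgrounds

/-!
# `Balaban1983to89.B11Thm1ExistsUniqueCoP7MG` — [Balaban1985Variational] = «[15]», Theorem 1 p. 279: THE EXISTENCE ∕ UNIQUENESS HALF OF THEOREM 1 AS A NAMED FACT IN NODE 00's HOUSE SHAPE, GUARD-GENERIC EDITION (`Adm : StepGuard F`, the currency of K0⁷'s REGISTERED (8)-token `Node00.VariationalThm1RegSepCoP7MG`)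
# («there exists a minimal orbit … This orbit is a unique critical orbit in the space (6) if B₃ε₁ ≤ ε₀ and ε₀ ≤ a₀»), the companion of K0⁷'s guarded (R)-reading `Node00.VariationalThm1RegSepCoP7MG` (`Record12BgRowCoClassCPMFloor` §4); floor-free edition = `B11Thm1ExistsUniqueCoP7M` (✓p740853)

Honest framing: statement-level skeleton of published theorems with citation tags; proofs where landed; nothing here is a claim about the Yang–Mills mass gap.  Cell `pub-ymgap`
(HUMAN RULINGS D-0062 ∕ D-0149), lane `pub-ymgap-dag-n12-c` g30 (typed g29; R134 seat (a), N12 = [B15], s1 — the CONSUMER lane of this fact; natural owner of the house = the node00-def lineage);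
count-neutral; N12 NOT discharged; finite 𝕋⁴ at fixed ε; nothing continuum ∕ ℝ⁴ ∕ OS ∕ mass-gap ∕ Clay.  A `Prop` WITH PARAMETERS, NEVER ASSERTED (no `sorry`, no `axiom`, no `instance`).

WHY.  N12's Proposition-1 road ([Balaban1989LargeFieldI] Prop. 1 p. 194; proof [Balaban1989LargeFieldII] pp. 358–359 «by Theorem 1 of [15] there exists exactly one (up to gauge)
minimal configuration») reads [15] Theorem 1 TWICE: its regularity clause (8) — K0⁷'s named fact `Node00.VariationalThm1RegSepCoP7M` (stmt-QuantumFields-20541's body), consumed BY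
NAME — and its EXISTENCE ∕ UNIQUENESS clause, so far displayed as an ANONYMOUS closed letter `h15EUT⁺` on the (J0′) road's head of record
(`Summits/…/BalabanUVNodesN12MinimiserFamilyKnitRowThm1LettersOnZOfRecordPos`, via `B15Prop1Thm1RowsOfExistsUniquePos`).  NODE 00's own roads never need that clause (the (2.12) solution
map `Node00.UminOfRecord` is TOTALISED: a chosen minimiser on the solvable set, the flat configuration off it), so nobody typed it.  THIS FILE names it, in EXACTLY the binder shape of K0⁷'s
`VariationalThm1RegSepTop7M` ∕ `…CoP7M` (every numerics `ν`, cube letter `M`, coupling history `g`, torus `K`, length `k`, separated (2.18) index `s : SeqOfRecord F ν M g K k` of record,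
`0 < ν.M₁`, thresholds `0 < δ_n ≤ a₁`, `B₃δ_n ≤ ε₀ ≤ a₀` comparable both ways, datum `W` with (7) on the support) PLUS ONE GUARD `0 < k` — print's lengths: at the tree's length-0 index
(the empty sequence, EMPTY determining set, where print's `𝔅₀ = {Λ₀ = Ω₀}` is everything) the uniqueness clause is FALSE (`B15Prop1Thm1LetterLengthZero.not_thm1TorusClassEU_allLengths`, the
flat configuration versus its centre twist) — with the conclusion «(∃ a minimiser of (5) over the class (6) at `ε₀` with the data `W` on `genSet s.Ω k`) ∧ (any two such minimisers
differ by a gauge transformation whose scale-`n` images at the two ends of every constrained bond are EQUAL AND CENTRAL)».  THE UNIQUENESS READING: print's group (4) p. 278 is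
«u(y) = 1 for y ∈ 𝔅_k»; that literal (residual) reading is false in the tree's model whenever the tower-site constraint graph is disconnected (the centre `Z(SU(N))` acting on one component
preserves class, data and action: dag-n12-w1 `B15Prop1LocalChartFromThm1AtBaseCentral` §0), so the sentence is typed modulo the DATUM-PRESERVING gauge transformations — for `SU(N)`
data the tower-CENTRAL ones — which is what print's proof (contraction in a gauge-fixed chart, Sect. C–G) establishes.
-- TODO(general form): [15] Thm 1 is printed for general admissible `{Ω_j}` ∕ `𝔅_k` ([Balaban1985RegularSpaces] Sect. A) with ONE threshold `ε₁`, and with the orbit group (4) taken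
-- literally; here: (2.18) indices of record, per-scale thresholds, uniqueness modulo tower-central gauges, lengths `0 < k`.

CONTENTS (statement-only).  §1 `VariationalThm1EUSepTop7MG` (top-domain selector `Sup`, as K0⁷'s FILE 12b∕12c), ★ `VariationalThm1EUSepCoP7MG` (at node00-def-R's support of record), the
definitional bridge `variationalThm1EUSepCoP7MG_iff` (`Iff.rfl`).  The bookkeeping bridges (floor-free ⇒ guarded `…toG`, antitone in the ceilings `…of_le` and in the guard `…anti`,
the trivial guard `…_true_iff` recovering ✓p740853) live in the sibling THEOREMS-ONLY module `B11Thm1ExistsUniqueCoP7MGBridges` (this file stays statement-only).  A consumer keyed on K0⁷'s REGISTERED guarded (8)-token (`…RegSepCoP7MG F 2 Adm B₃ a₀ a₁`, dag-n12-d g26's (α)–(ε) editions) keys on `VariationalThm1EUSepCoP7MG F 2 Adm B₃ a₀ a₁` by name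
with the same guard (its `Adm ν' M g K k' s` antecedent discharged at the flat history exactly as for the (8)-token).  Floor-free ⇒ guarded (drop the antecedent), not conversely.

HONEST SCOPE.  A named `Prop`, never asserted; NO producer in the tree (an N07 ∕ NODE-00 obligation: [15] Props 2–9); its only consumer is N12's (J0′) road; count-neutral; K0⁷ ∕ K1⁹ NOT
closed; nothing continuum ∕ ℝ⁴ ∕ OS; the YM mass gap (Clay) is NOT proved by any of this.
-/

noncomputable section

namespace Literature.MathematicalPhysics.QuantumFieldTheory.Balaban1983to89.B11Thm1ExistsUniqueCoP7MG

open T4Continuum B15DeterminingSets GaugeField Node00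
open B16Sect1Backgrounds (toMS)

section NamedFact

variable (F : T4Family) (N : ℕ) [NeZero N]

/-- **★ NAMED FACT — [15] THEOREM 1, EXISTENCE OF THE MINIMAL ORBIT AND ITS UNIQUENESS (MODULO TOWER-CENTRAL GAUGES) OVER PRINT'S CLASS (6) ON A TOP DOMAIN `Ω₀ = Sup ν K s.Ω`,
THRESHOLDS COMPARABLE BOTH WAYS, `M₁ ≥ 1`, LENGTHS `0 < k`** (a `Prop` with parameters, NEVER asserted): the antecedents of K0⁷'s `VariationalThm1RegSepTop7M` VERBATIM plus the
length guard `0 < k`; conclusion: a minimiser of the Wilson action over the class (6) at `ε₀` with the data `W` on the (2.2) determining set `genSet s.Ω k` EXISTS, and any two such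
minimisers `U₁, U₂` satisfy `U₂ = U₁^u` for a gauge transformation `u` whose scale-`n` images `toMS u n` at the two ends of every constrained bond of scale `n ≤ k` are equal and
central.  Verbatim p. 279: *«there exists a minimal orbit in the space (8). This orbit is a unique critical orbit in the space (6) if B₃ε₁ ≤ ε₀ and ε₀ ≤ a₀.»*
-- TODO(general form): print's orbit group (4) «u(y) = 1 for y ∈ 𝔅_k» read modulo the centre (datum-preserving gauges); general admissible `{Ω_j}`; one threshold `ε₁`.
[cite: Balaban1985Variational, Thm 1 p.279, (1) p.277, (2)–(7) p.278; Balaban1985RegularSpaces, (1.3)–(1.9) p.77; Balaban1988Convergent, p.255, (2.2) p.255, (2.12) p.256, (2.18) p.257] -/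
def VariationalThm1EUSepTop7MG (Sup : (ν : Stage7Numerics) → (K : ℕ) → (ℕ → Set (Site (F.P K) 0)) → Set (Site (F.P K) 0)) (Adm : StepGuard F) (B₃ a₀ a₁ : ℝ) : Prop :=
  ∀ (ν : Stage7Numerics) (M : ℕ) (g : ℕ → ℝ) (K k : ℕ) (s : SeqOfRecord F ν M g K k), 0 < k → Sect2.SeqSeparated ν.M₁ s → 0 < ν.M₁ → Adm ν M g K k s → ∀ (ε₀ : ℝ) (δ : ℕ → ℝ),
    (∀ n, n ≤ k → 0 < δ n ∧ δ n ≤ a₁ ∧ B₃ * δ n ≤ ε₀) → (∀ n, n < k → δ n ≤ 2 * δ (n + 1)) → (∀ n, n < k → δ (n + 1) ≤ 2 * δ n) → ε₀ ≤ a₀ →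
    ∀ W : MSField (F.P K) (SU N), Sect2.DataSmall7PTop (avOfRecord F N K) s.Ω (Sup ν K s.Ω) k δ W →
      (∃ U₀ : GaugeField (F.P K) 0 (SU N), IsMinimizer (avOfRecord F N K)
          {U | (∀ n, n ≤ k → PlaqSmallOn (Sect2.omegaPlaqsTop s.Ω (Sup ν K s.Ω) n) (ε₀ * (F.P K).eta n ^ 2) U) ∧
            Sect2.CoDivClassOnTop s.Ω (Sup ν K s.Ω) k ε₀ U} (genSet s.Ω k) W U₀) ∧
      ∀ U₁ U₂ : GaugeField (F.P K) 0 (SU N),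
        IsMinimizer (avOfRecord F N K)
            {U | (∀ n, n ≤ k → PlaqSmallOn (Sect2.omegaPlaqsTop s.Ω (Sup ν K s.Ω) n) (ε₀ * (F.P K).eta n ^ 2) U) ∧
              Sect2.CoDivClassOnTop s.Ω (Sup ν K s.Ω) k ε₀ U} (genSet s.Ω k) W U₁ →
        IsMinimizer (avOfRecord F N K)
            {U | (∀ n, n ≤ k → PlaqSmallOn (Sect2.omegaPlaqsTop s.Ω (Sup ν K s.Ω) n) (ε₀ * (F.P K).eta n ^ 2) U) ∧
              Sect2.CoDivClassOnTop s.Ω (Sup ν K s.Ω) k ε₀ U} (genSet s.Ω k) W U₂ →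
        ∃ u : GaugeTransf (F.P K) 0 (SU N),
          (∀ n, n ≤ k → ∀ b ∈ bondsOf (genSet s.Ω k n), toMS u n b.src = toMS u n b.tgt ∧ ∀ g : SU N, toMS u n b.src * g = g * toMS u n b.src) ∧
            gaugeAct u U₁ = U₂

/-- **★★ NAMED FACT, `CoP` EDITION — [15] THEOREM 1 (EXISTENCE ∕ UNIQUENESS) OVER CLASS (6) ON THE SUPPORT OF RECORD `suppDomOfRecord`**: §1's `VariationalThm1EUSepTop7MG` at
node00-def-R's selector (class literal = `regMSCoPOfRecord F N ν K k s.Ω` with `ε₀` for `εreg`, by `rfl`) — the existence ∕ uniqueness companion of K0⁷'s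
`Node00.VariationalThm1RegSepCoP7M`; the token N12's (J0′) road consumes BY NAME.  A `Prop` with parameters, NEVER asserted; NO producer in the tree.
-- TODO(general form): as above.
[cite: Balaban1985Variational, Thm 1 p.279, (2)–(7) p.278; Balaban1988Convergent, p.255, (2.12) p.256] -/
def VariationalThm1EUSepCoP7MG (Adm : StepGuard F) (B₃ a₀ a₁ : ℝ) : Prop :=
  VariationalThm1EUSepTop7MG F N (fun ν K Ω => suppDomOfRecord F ν K Ω) Adm B₃ a₀ a₁

variable {F N}

/-- The `CoP` edition IS the top-domain fact at node00-def-R's selector of record (definitional). [cite: Balaban1985Variational, Thm 1 p.279 (bookkeeping)] -/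
theorem variationalThm1EUSepCoP7MG_iff {Adm : StepGuard F} {B₃ a₀ a₁ : ℝ} :
    VariationalThm1EUSepCoP7MG F N Adm B₃ a₀ a₁ ↔ VariationalThm1EUSepTop7MG F N (fun ν K Ω => suppDomOfRecord F ν K Ω) Adm B₃ a₀ a₁ := Iff.rfl

end NamedFact

end Literature.MathematicalPhysics.QuantumFieldTheory.Balaban1983to89.B11Thm1ExistsUniqueCoP7MG

end
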